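import Mathlib.Tactic.DeriveFintype
import Mathlib.Data.Fintype.Card
import Mathlib.Data.Finset.Card
import HarnessLib

/-!
# TABLE X of cell `pub-hodgeav-hg6` — the dimension-6 Hodge-group exception table as a finite token type

Cell `pub-hodgeav-hg6` (charter req-37 (A), Q2b; director-hodge R16.10: "`SixfoldHodgeTypes.lean` = finite token type +
verdict function"). This module is PURE BOOKKEEPING, kernel-checked for internal consistency only: it contains NO
geometry, asserts NOTHING about abelian varieties, and proves nothing about the Hodge conjecture (`HC`, `HC_AV`,
`HC_CM` are NOT proved anywhere in the tree). Its companion `Theorems/SixfoldTableXCover.lean` is the geometric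
statement (`TableX.hcAtDim_six_of_tableX_residues`: HC in dimension `6` ⟸ two Markman facts + `HC_CM` (binder) +
R-K3P + R-W6 + two dimension-6 census nodes); the dossier behind both is the cell's `TABLE-X-g6` (consolidated from
cell `pub-hodge-ring2`'s `AV-HODGE-ATLAS` §4/§10/§14/§22–§24/§33–§39, every load-bearing number certified by ≥ 2
independent engines there, plus this cell's third-engine jobs J1–J6).

## The tokens
One token per Hodge-group type of a complex abelian SIXFOLD `X` (simple: Albert type with `e·d²·m = 12` and the
Mumford–Tate constraints; non-simple: product configurations by Hodge-group dependence), in the numbering of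
`TABLE-X-g6` §1 (rows 1–31). `exc₂ t`, `exc₃ t` are the dimensions of the exceptional (not divisor-generated) parts of
`B²(X)`, `B³(X)` for the general member of the row, as certified in the atlas (numbers of record, copied with their
locators; `0` where `B = D`).

## The verdicts
* `print`        — HC for every member of the row is in REFEREED print (atlas §33–§39 tally: 10 rows at dim 6);
* `cert`         — `B• = D•` certified (≥ 2 engines; Hg input derived), so the kernel's divisorial engine decides the
                   row once the census node grants it; no print locator states the row;
* `weilLower`    — exceptional classes are pulled back from Weil classes in dimension `< 6` (refereed: Floccari–Fu;
                   Markman fourfolds);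
* `floorProduct` — non-interacting product: `B•(X) = ⊗ B•(Yᵢ^{nᵢ})`, every factor power of dimension `≤ 5` (floor);
* `cmKernel`     — CM, nondegenerate: instance decided UNCONDITIONALLY in the tree (Hazama; `CorCM` by name);
* `weilCarrier`  — the row carries sixfold Weil classes `W_k` (`k` imaginary quadratic acting with multiplicities
                   `(3,3)`): decided PER MEMBER by the Landherr discriminant class `δ(H_k) ∈ ℚˣ/N(kˣ)` — SPLIT
                   (`δ = [-1]`) ⇒ printed range (`Markman2025_weilClasses_algebraic_hyperbolicSixfold`, UNREFEREED;
                   Schoen `d = 3` / Koike `d = 1` refereed), NON-SPLIT ⇒ residue R-W6 = `WeilTypeLadder.NonsplitSixfolds`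
                   (rung H2); the invariant per row is job J5 (row 7: `c = -Nrd T`, job J2-bis);
* `residueK3P`   — the K3-partner line `G ⊂ H²(Y) ⊗ T(Z)` on `S_CM × Y₄/E` (job J3: `B• = D• ⊕ D•(Y)·G`); OPEN, not in
                   print; tree cell `Ring2.Atlas.HodgeQuarticTypeIVFourfoldTimesCMSurface`;
* `cmBinder`     — CM, degenerate (Weil fibre `(3,3)` over an imaginary quadratic subfield): displayed binder `HC_CM`;
* `cmMixed`      — CM products: nondegenerate members kernel-decided, degenerate members under the binder `HC_CM`;
* `empty`        — the row is EMPTY / VACUOUS in dimension 6 (census; Pink 1998 Thm. 5.14; atlas §23).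

## What is checked (by `decide`)
`card_token` (31 tokens); `card_suffices` / `card_residual` / `card_empty` (15 / 14 / 2); `exc_eq_zero_of_suffices`
(every "suffices" row other than the `weilLower` row has `exc₂ = exc₃ = 0`); `exc_ne_zero_of_residual` (every residual
row carries an exceptional class); `weilCarrier_exc₃` (every Weil-carrier row has `exc₂ = 0 < exc₃`).
-/

set_option linter.dupNamespace false

namespace Summit.HodgeConjecture.HodgeConjecture.TableX

/-- Verdict codes of TABLE X (see the module docstring). [folklore] -/
inductive Verdict
  | print | cert | weilLower | floorProduct | cmKernel
  | weilCarrier | residueK3P | cmBinder | cmMixed | empty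
  deriving DecidableEq, Repr

/-- The 31 Hodge-group type tokens of complex abelian sixfolds, numbered as the rows of `TABLE-X-g6` §1.
Simple rows: `simpleI1` … `simpleIV31Weil`, CM rows; product rows `exS5` … `cmProducts`; `cmRankLeFive`, `vacuous`
are the two provably empty rows. [folklore] -/
inductive Token
  | simpleI1            -- 1  End⁰ = ℚ, Hg = Sp₁₂
  | simpleI2            -- 2  real quadratic RM
  | simpleI3            -- 3  totally real cubic
  | simpleI6            -- 4  totally real sextic
  | simpleII1           -- 5  indefinite quaternion / ℚ
  | simpleII3           -- 6  indefinite quaternion / real cubic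
  | simpleIII1          -- 7  definite quaternion D/ℚ, m = 3
  | simpleIV11          -- 8  imaginary quadratic, signature (5,1) | (4,2)
  | weilGeneral33       -- 9  k acting (3,3), general member of a (k,δ) component
  | simpleIV21other     -- 10 quartic CM E, no (3,3) subfield pairing
  | simpleIV21Weil      -- 11 E = kE₀ ∋ k acting (3,3)
  | simpleIV31generic   -- 12 sextic CM F, patterns P51/P42
  | simpleIV31Weil      -- 13 F = kF₀, pattern P33
  | cmSimpleNondeg      -- 14 CM deg 12, nondegenerate (259/280 types)
  | cmSimpleDeg33       -- 15 CM deg 12, balanced (3,3) over k (21/280 types)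
  | exS5                -- 16 E × Y₅ with product Hodge group (control)
  | exY5k32             -- 17 E_k × Y₅/k (3,2)
  | exY5k41             -- 18 E_k × Y₅/k (4,1)
  | y3xY3k              -- 19 Y₃/k (2,1) × Y₃′/k
  | e2xY4k31            -- 20 E_k² × Y₄/k (3,1)
  | e3xY3k21            -- 21 E_k³ × Y₃/k (2,1)
  | y3xZ3cm             -- 22 Y₃/k × Z₃ (CM sextic ⊃ k)
  | sxY4Ecyclic         -- 23 S_CM × Y₄/E, E cyclic quartic      (K3-partner)
  | sxY4ED4aligned      -- 24 S_CM × Y₄/E, E non-Galois, aligned (K3-partner)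
  | sxY4ED4other        -- 25 the non-aligned D₄ configurations (control)
  | ek1ek2xY4Ebiquad    -- 26 E_{k₁} × E_{k₂} × Y₄/E, E biquadratic (K3-partner)
  | ek2xY4Mbiquad       -- 27 E_k² × Y₄/M, M biquadratic ⊃ k
  | nonInteracting      -- 28 non-interacting products
  | cmProducts          -- 29 interacting CM products
  | cmRankLeFive        -- 30 CM simple of rank ≤ 5: EMPTY
  | vacuous             -- 31 Mumford-type / smaller-Hg simple sixfolds: VACUOUS
  deriving DecidableEq, Repr, Fintype

open Token Verdict

/-- The verdict function of TABLE X (v1, 2026-08-28). [folklore] -/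
def verdict : Token → Verdict
  | simpleI1 => print | simpleI2 => print | simpleI3 => print | simpleI6 => print
  | simpleII1 => print | simpleII3 => print
  | simpleIII1 => weilCarrier
  | simpleIV11 => print
  | weilGeneral33 => weilCarrier
  | simpleIV21other => print | simpleIV21Weil => weilCarrier
  | simpleIV31generic => cert | simpleIV31Weil => weilCarrier
  | cmSimpleNondeg => cmKernel | cmSimpleDeg33 => cmBinder
  | exS5 => print | exY5k32 => weilCarrier | exY5k41 => cert
  | y3xY3k => weilCarrier | e2xY4k31 => weilCarrier | e3xY3k21 => weilLower | y3xZ3cm => weilCarrier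
  | sxY4Ecyclic => residueK3P | sxY4ED4aligned => residueK3P | sxY4ED4other => cert
  | ek1ek2xY4Ebiquad => residueK3P | ek2xY4Mbiquad => weilCarrier
  | nonInteracting => floorProduct | cmProducts => cmMixed
  | cmRankLeFive => empty | vacuous => empty

/-- `exc₂`: dimension of the exceptional part of `B²(X)` for the general member (atlas numbers of record). [folklore] -/
def exc₂ : Token → ℕ
  | e3xY3k21 => 6
  | sxY4Ecyclic => 4 | sxY4ED4aligned => 4 | ek1ek2xY4Ebiquad => 4
  | cmProducts => 4      -- e.g. B × E′ × E″ (ζ₂₄): exc₂ = 4 (kernel census p176557)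
  | _ => 0

/-- `exc₃`: dimension of the exceptional part of `B³(X)` for the general member (atlas numbers of record; `2` =
one pair of Weil lines `W_k = ∧⁶_k ⊕ conj`, `7` = `Σ_{k ⊂ D} W_k` on the type-III(1) row). [folklore] -/
def exc₃ : Token → ℕ
  | simpleIII1 => 7
  | weilGeneral33 => 2 | simpleIV21Weil => 2 | simpleIV31Weil => 2 | cmSimpleDeg33 => 2
  | exY5k32 => 2 | y3xY3k => 2 | e2xY4k31 => 2 | y3xZ3cm => 2 | ek2xY4Mbiquad => 2
  | e3xY3k21 => 18
  | sxY4Ecyclic => 4 | sxY4ED4aligned => 4 | ek1ek2xY4Ebiquad => 4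
  | cmProducts => 4
  | _ => 0

/-- "Suffices" verdicts: known methods (print / certificate / lower-dimensional Weil classes / floor / CM kernel
theorems) decide every member. [folklore] -/
def Verdict.suffices : Verdict → Bool
  | print | cert | weilLower | floorProduct | cmKernel => true
  | _ => false

/-- "Residual" verdicts: the row carries a named residue (R-W6 per member, R-K3P) or the binder `HC_CM`. [folklore] -/
def Verdict.residual : Verdict → Bool
  | weilCarrier | residueK3P | cmBinder | cmMixed => true
  | _ => false

/-- TABLE X has 31 tokens. [folklore] -/
theorem card_token : Fintype.card Token = 31 := by decide

/-- 15 rows are decided by known methods. [folklore] -/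
theorem card_suffices : (Finset.univ.filter fun t => (verdict t).suffices).card = 15 := by decide

/-- 14 rows carry a named residue or the binder. [folklore] -/
theorem card_residual : (Finset.univ.filter fun t => (verdict t).residual).card = 14 := by decide

/-- 2 rows are provably empty in dimension 6. [folklore] -/
theorem card_empty : (Finset.univ.filter fun t => verdict t = empty).card = 2 := by decide

/-- Every token has exactly one of the three statuses. [folklore] -/
theorem suffices_or_residual_or_empty (t : Token) :
    (verdict t).suffices = true ∨ (verdict t).residual = true ∨ verdict t = empty := by
  revert t; decide

/-- Consistency: a "suffices" row other than the `weilLower` row has no exceptional classes in `B²`, `B³`. [folklore] -/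
theorem exc_eq_zero_of_suffices (t : Token) (h : (verdict t).suffices = true) (h' : verdict t ≠ weilLower) :
    exc₂ t = 0 ∧ exc₃ t = 0 := by
  revert t; decide

/-- Consistency: every residual row carries an exceptional class. [folklore] -/
theorem exc_ne_zero_of_residual (t : Token) (h : (verdict t).residual = true) : exc₂ t ≠ 0 ∨ exc₃ t ≠ 0 := by
  revert t; decide

/-- Consistency: every Weil-carrier row has `B² = D²` and a non-zero exceptional part in `B³`. [folklore] -/
theorem weilCarrier_exc₃ (t : Token) (h : verdict t = weilCarrier) : exc₂ t = 0 ∧ 0 < exc₃ t := by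
  revert t; decide

/-- The residual tokens, listed. [folklore] -/
theorem residual_tokens :
    (Finset.univ.filter fun t => (verdict t).residual) =
      {simpleIII1, weilGeneral33, simpleIV21Weil, simpleIV31Weil, cmSimpleDeg33, exY5k32, y3xY3k, e2xY4k31,
        y3xZ3cm, sxY4Ecyclic, sxY4ED4aligned, ek1ek2xY4Ebiquad, ek2xY4Mbiquad, cmProducts} := by
  decide

end Summit.HodgeConjecture.HodgeConjecture.TableX
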